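import Summits.MatrixMultiplication.MatrixMultiplication.Theorems.EdgePencilSixthCertificates
import Summits.MatrixMultiplication.MatrixMultiplication.Theorems.EdgePencilReroutingCover
import HarnessLib

/-!
# The tetrahedral dual exponent `α(K₄) = sup {δ ∈ [0,1] | χ(δ) = ω(2,1,2)}`: the rung side of
# `TetraExcessZero` as ONE REAL NUMBER, its laws, and its dictionary to Coppersmith's `α`

Support kernel for `stmt-MatrixMultiplication-26697` (`TetraExcessZero : ω(K₄) ≤ ω(2,1,2)`, route
`TetrahedronCarving`; registered line `Cruxes/TetraExcessZero/Lines/rung_and_chord.lean`, stubs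
`stub_sixRungPos : ∃ δ > 0, χ(δ) ≤ ω(2,1,2)`, `stub_midTight : ω(2,1,2) + ω(K₄) ≤ 2χ(1/2)`; lineage
`decomp-mm-lens-6`, generation 37). ONE new definition (`tetraAlpha : ℝ`), no instance, no notation, no
`sorry`, no new axiom; no item is added or changed; the cut `closes (hA : TetraExcessZero) (hB : TetraPlusTwo)`
is untouched. NOTATION: `χ(δ) = omegaSix F δ` (`EdgePencilSixthLadder`), `ψ = ω(2,1,2) = χ(0)`, `T = ω(K₄) = χ(1)`.

DICTIONARY (graph tensors, CVZ §1.1). Coppersmith's `α = α(K₃) = sup {a ∈ [0,1] | the exponent of K₃ with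
third edge of bond n^a equals that of (K₃ − e)_n = 2}` (`dualExponentAlpha`) ∥ `α(K₄) = sup {δ ∈ [0,1] | the
exponent of K₄ with sixth edge of bond n^δ equals that of (K₄ − e)_n = ψ}` (`tetraAlpha`). Row by row:
* `α(K₃) = 1 ⟺ ω = 2` (`dualExponentAlpha_eq_one_iff`) ∥ `α(K₄) = 1 ⟺ TetraExcessZero`
  (`tetraExcessZero_iff_tetraAlpha_eq_one`); `ω = 2 ⟹ α(K₃) = α(K₄) = 1`; `ω = 2 ⟺ α(K₄) = 1 ∧ TetraPlusTwo`
  (`matrixMultiplication_iff_tetraAlpha_eq_one_and_tetraPlusTwo`, the route's cut).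
* the sup is a max: `ω(1, α, 1) = 2` (`omegaRect_dualExponentAlpha`) ∥ `χ(α(K₄)) = ψ` (`omegaSix_tetraAlpha`),
  level set `[0, α(K₄)]` (`setOf_sixRung_eq_Icc`) — both by `1`-Lipschitz continuity
  (`lipschitzWith_omegaRect_one_mid_one` ∥ `lipschitzWith_omegaSix`, §1, NEW for `χ`:
  `χ(δ') ≤ χ(δ) + (δ' − δ)`, the block decomposition between two arbitrary bonds).
* `0.1722 < α(K₃)` (Coppersmith 1982, `coppersmith1982_dualExponentAlpha_gt`, a THEOREM of the tree) ∥
  `0 < α(K₄)` is EXACTLY `stub_sixRungPos` (`sixRungPos_iff_tetraAlpha_pos`) — OPEN; the record is `α(K₄) ≥ 0`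
  (`sixRung_zero`). The one transfer in the tree: `1/2 < α(K₃) ⟹ 0 < α(K₄)`, quantitatively
  `α(K₄) ≥ (1 − 1/(2a))·α₀` for `1/2 < a ≤ α(K₃)` (`le_tetraAlpha_of_half_lt`; re-routing cover; `α₀ = log₅4/5`).
* payoff: `δ ≤ α(K₄)` gives `T − ψ ≤ (1 − α(K₄))/(5 + α(K₄))·ψ` (`excess_le_symm_tetraAlpha`); conversely the
  excess caps `α(K₄)`: `(5 + α(K₄))·T ≤ 6ψ` (`five_add_tetraAlpha_mul_le`); an ABSOLUTE rung `χ(δ) ≤ 4`, `δ > 0`,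
  is exactly `HalfAlpha ∧ 0 < α(K₄)` (`absRung_iff_halfAlpha_and_tetraAlpha_pos`).
* `α(K₄) < 1 ⟺ ¬TetraExcessZero ⟹ ω > 2` (`not_matrixMultiplication_of_tetraAlpha_lt_one`).
PROFILE (§4): `χ = ψ` on `[0, α(K₄)]`, `χ > ψ` on `(α(K₄), 1]` and there below the chord from `(α(K₄), ψ)` to
`(1, T)` (`omegaSix_le_chord_tetraAlpha`, sharpening `omegaSix_le_chord` = the case `α(K₄) = 0`);
`MidTight ⟹ α(K₄) ∈ {0,1}` (`tetraAlpha_eq_zero_or_eq_one_of_midTight`), so the registered line reads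
`0 < α(K₄) → MidTight → α(K₄) = 1` (`tetraAlpha_eq_one_of_pos_of_midTight`).
NOT here: no lower bound `α(K₄) > 0` (the crux's open rung half), no mechanism — the object makes rung-side
progress MEASURABLE (every certified `χ(δ₀) ≤ ψ` is a record `α(K₄) ≥ δ₀`, as the `α`-records
`0.172 → 0.294 → 0.30298 → 0.31389 → 0.321334`), nothing more.

References: [Coppersmith1982] Thm. 1; [LeGall2012] §1; [LottiRomani1983] §2; [ChristandlVranaZuiddam2016]
(arXiv:1609.07476) §1.1, Prop. 1.1.16, 1.1.26; [ChristandlLeGallLysikovZuiddam2025] Rem. 3.13. -/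

noncomputable section
set_option linter.dupNamespace false

open Filter Asymptotics Literature.Computability.AlgebraicComplexity
open Summit.MatrixMultiplication.MatrixMultiplication.Theorems.TetrahedronTensor
open Summit.MatrixMultiplication.MatrixMultiplication.Theorems.TetraDiagonal
open Summit.MatrixMultiplication.MatrixMultiplication.Theses.TetrahedronCarving

namespace Summit.MatrixMultiplication.MatrixMultiplication.Theorems.EdgePencil

/-! ## §1 The ladder is `1`-Lipschitz: `χ(δ') ≤ χ(δ) + (δ' − δ)` between any two bonds -/

section Lipschitz

variable (F : Type) [Field F]

/-- **Block cover between two bonds**: `β` admissible at `δ` ⟹ `β + (δ' − δ)` admissible at `δ' ≥ δ`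
(`⌈n^{δ'}⌉ ≤ ⌈n^δ⌉·⌈n^{δ'−δ}⌉`, bond monotonicity, block bound `R₄(W_n^{(B·e)}) ≤ B·R₄(W_n^{(e)})`; the
cases `δ = 0`, `δ' = 1` were in the tree). [cite: ChristandlVranaZuiddam2016, Prop. 1.1.16] -/
theorem add_sub_mem_sixAdmissibleExponents {δ δ' β : ℝ} (h : δ ≤ δ')
    (hβ : β ∈ sixAdmissibleExponents F δ) : β + (δ' - δ) ∈ sixAdmissibleExponents F δ' := by
  obtain ⟨C, hC0, hC⟩ := bound_of_isBigO_nat_atTop hβ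
  refine IsBigO.of_bound (2 * C) ?_
  filter_upwards [eventually_ge_atTop 1] with n hn
  have hn0 : (0 : ℝ) < n := by exact_mod_cast hn
  have hR : (tensorRankD (sixTetra F n (rectDim n δ)) : ℝ) ≤ C * (n : ℝ) ^ β := by
    have h := hC (Real.rpow_pos_of_pos hn0 β).ne'
    rwa [Real.norm_of_nonneg (Nat.cast_nonneg _), Real.norm_of_nonneg (Real.rpow_nonneg hn0.le _)]
      at h
  have hd : (rectDim n (δ' - δ) : ℝ) ≤ 2 * (n : ℝ) ^ (δ' - δ) := by
    have hb := rectDim_le hn (δ' - δ)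
    rwa [max_eq_left (sub_nonneg.2 h)] at hb
  have he : 0 < rectDim n δ := one_le_rectDim hn δ
  have hfin : tensorRankD (sixTetra F n (rectDim n δ')) ≤
      rectDim n (δ' - δ) * tensorRankD (sixTetra F n (rectDim n δ)) := by
    have h1 := tensorRankD_sixTetra_mono (F := F) (n := n) (rectDim_le_rectDim_mul_rectDim hn δ' δ)
    rw [mul_comm] at h1
    exact h1.trans (tensorRankD_sixTetra_mul_le he _)
  rw [Real.norm_of_nonneg (Nat.cast_nonneg _), Real.norm_of_nonneg (Real.rpow_nonneg hn0.le _),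
    Real.rpow_add hn0]
  calc (tensorRankD (sixTetra F n (rectDim n δ')) : ℝ)
      ≤ (rectDim n (δ' - δ) : ℝ) * (tensorRankD (sixTetra F n (rectDim n δ)) : ℝ) := by
        exact_mod_cast hfin
    _ ≤ (2 * (n : ℝ) ^ (δ' - δ)) * (C * (n : ℝ) ^ β) :=
        mul_le_mul hd hR (Nat.cast_nonneg _) (by positivity)
    _ = 2 * C * ((n : ℝ) ^ β * (n : ℝ) ^ (δ' - δ)) := by ring

/-- **`χ(δ') ≤ χ(δ) + (δ' − δ)`** for `δ ≤ δ'`: thickening the sixth edge from bond `n^δ` to `n^{δ'}`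
costs at most the added bond. [cite: ChristandlVranaZuiddam2016, Prop. 1.1.16] -/
theorem omegaSix_le_omegaSix_add {δ δ' : ℝ} (h : δ ≤ δ') :
    omegaSix F δ' ≤ omegaSix F δ + (δ' - δ) := by
  have h1 : ∀ β ∈ sixAdmissibleExponents F δ, omegaSix F δ' - (δ' - δ) ≤ β := fun β hβ => by
    have h2 := csInf_le (sixAdmissibleExponents_bddBelow F δ')
      (add_sub_mem_sixAdmissibleExponents F h hβ)
    change omegaSix F δ' ≤ β + (δ' - δ) at h2
    linarith
  have h3 := le_csInf (sixAdmissibleExponents_nonempty F δ) h1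
  change omegaSix F δ' - (δ' - δ) ≤ omegaSix F δ at h3
  linarith

/-- **`χ` is `1`-Lipschitz** (monotone + the one-sided estimate; cf. `lipschitzWith_omegaRect_one_mid_one`
for `p ↦ ω(1,p,1)`). [cite: ChristandlLeGallLysikovZuiddam2025, Rem. 3.13] -/
theorem lipschitzWith_omegaSix : LipschitzWith 1 (omegaSix F) := by
  refine LipschitzWith.of_le_add fun p q => ?_
  rcases le_total q p with hqp | hpq
  · calc omegaSix F p ≤ omegaSix F q + (p - q) := omegaSix_le_omegaSix_add F hqp
      _ ≤ omegaSix F q + dist p q := by rw [Real.dist_eq]; gcongr; exact le_abs_self _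
  · calc omegaSix F p ≤ omegaSix F q := omegaSix_mono F hpq
      _ ≤ omegaSix F q + dist p q := le_add_of_nonneg_right dist_nonneg

/-- `χ` is continuous. [cite: ChristandlLeGallLysikovZuiddam2025, Rem. 3.13] -/
theorem continuous_omegaSix : Continuous (omegaSix F) :=
  (lipschitzWith_omegaSix F).continuous

end Lipschitz

/-! ## §2 The object `α(K₄)`: the supremum is attained and the level set is `[0, α(K₄)]` -/

section Alpha

variable (F : Type) [Field F]

/-- **The tetrahedral dual exponent** `α(K₄) := sup {δ ∈ [0,1] | χ(δ) ≤ ω(2,1,2)}`: the largest fraction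
of the sixth edge that the diamond `K₄ − e` absorbs at no exponent cost — the `K₄`-analogue of Coppersmith's
`α = sup {a ∈ [0,1] | ω(1,a,1) = 2}` (`dualExponentAlpha`, third edge of `K₃` vs the path `K₃ − e`). The
clamp to `[0,1]` matters: `χ` saturates (`χ(δ) = T` for `δ ≥ 1`). [cite: LeGall2012, §1] -/
def tetraAlpha : ℝ :=
  sSup {δ : ℝ | δ ∈ Set.Icc (0 : ℝ) 1 ∧ omegaSix F δ ≤ omegaRect F 2 1 2}

/-- `0` lies in the level set (the bottom rung `χ(0) = ω(2,1,2)` is a theorem, `sixRung_zero`). -/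
theorem zero_mem_setOf_sixRung :
    (0 : ℝ) ∈ {δ : ℝ | δ ∈ Set.Icc (0 : ℝ) 1 ∧ omegaSix F δ ≤ omegaRect F 2 1 2} :=
  ⟨⟨le_rfl, zero_le_one⟩, sixRung_zero F⟩

/-- The level set is bounded above by `1`. -/
theorem bddAbove_setOf_sixRung :
    BddAbove {δ : ℝ | δ ∈ Set.Icc (0 : ℝ) 1 ∧ omegaSix F δ ≤ omegaRect F 2 1 2} :=
  ⟨1, fun _ h => h.1.2⟩

/-- The level set is closed (continuity of `χ`, §1). [folklore] -/
theorem isClosed_setOf_sixRung :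
    IsClosed {δ : ℝ | δ ∈ Set.Icc (0 : ℝ) 1 ∧ omegaSix F δ ≤ omegaRect F 2 1 2} :=
  isClosed_Icc.inter (isClosed_le (continuous_omegaSix F) continuous_const)

/-- `0 ≤ α(K₄)`. -/
theorem tetraAlpha_nonneg : 0 ≤ tetraAlpha F :=
  Real.sSup_nonneg fun _ h => h.1.1

/-- `α(K₄) ≤ 1`. -/
theorem tetraAlpha_le_one : tetraAlpha F ≤ 1 :=
  Real.sSup_le (fun _ h => h.1.2) zero_le_one

/-- **Lower bounds on `α(K₄)` are rungs**: `χ(δ) ≤ ω(2,1,2)` with `δ ∈ [0,1]` gives `δ ≤ α(K₄)`. -/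
theorem le_tetraAlpha {δ : ℝ} (hδ : δ ∈ Set.Icc (0 : ℝ) 1) (hr : omegaSix F δ ≤ omegaRect F 2 1 2) :
    δ ≤ tetraAlpha F :=
  le_csSup (bddAbove_setOf_sixRung F) ⟨hδ, hr⟩

/-- **The supremum is attained: `χ(α(K₄)) = ω(2,1,2)`** (closed, non-empty, bounded level set; cf.
`omegaRect_dualExponentAlpha`). [cite: LeGall2012, §1] -/
theorem omegaSix_tetraAlpha : omegaSix F (tetraAlpha F) = omegaRect F 2 1 2 :=
  le_antisymm
    ((isClosed_setOf_sixRung F).csSup_mem ⟨0, zero_mem_setOf_sixRung F⟩ (bddAbove_setOf_sixRung F)).2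
    (omegaRect_two_one_two_le_omegaSix F _)

/-- Every `δ ≤ α(K₄)` is a rung (monotonicity and attainment). -/
theorem sixRung_of_le_tetraAlpha {δ : ℝ} (h : δ ≤ tetraAlpha F) :
    omegaSix F δ ≤ omegaRect F 2 1 2 :=
  (omegaSix_mono F h).trans (omegaSix_tetraAlpha F).le

/-- **`χ(δ) ≤ ω(2,1,2) ⟺ δ ≤ α(K₄)`** for every `δ ≤ 1` (for `δ > 1` the rung is the leaf itself).
[cite: LeGall2012, §1] -/
theorem sixRung_iff_le_tetraAlpha {δ : ℝ} (hδ1 : δ ≤ 1) :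
    omegaSix F δ ≤ omegaRect F 2 1 2 ↔ δ ≤ tetraAlpha F := by
  refine ⟨fun hr => ?_, sixRung_of_le_tetraAlpha F⟩
  rcases lt_or_ge δ 0 with hδ0 | hδ0
  · exact hδ0.le.trans (tetraAlpha_nonneg F)
  · exact le_tetraAlpha F ⟨hδ0, hδ1⟩ hr

/-- `χ = ω(2,1,2)` on `(−∞, α(K₄)]`: the FLAT PART of the ladder. -/
theorem omegaSix_eq_of_le_tetraAlpha {δ : ℝ} (h : δ ≤ tetraAlpha F) :
    omegaSix F δ = omegaRect F 2 1 2 :=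
  (omegaSix_le_iff_eq F δ).1 (sixRung_of_le_tetraAlpha F h)

/-- Above `α(K₄)` (and up to `1`) the ladder is STRICTLY above its floor. -/
theorem omegaRect_lt_omegaSix_of_tetraAlpha_lt {δ : ℝ} (h : tetraAlpha F < δ) (hδ1 : δ ≤ 1) :
    omegaRect F 2 1 2 < omegaSix F δ :=
  lt_of_not_ge fun hr => (not_le.2 h) ((sixRung_iff_le_tetraAlpha F hδ1).1 hr)

/-- **The level set is the interval `[0, α(K₄)]`** (analogue of `setOf_omegaRect_eq_two_eq_Icc`).
[cite: LeGall2012, §1] -/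
theorem setOf_sixRung_eq_Icc :
    {δ : ℝ | δ ∈ Set.Icc (0 : ℝ) 1 ∧ omegaSix F δ ≤ omegaRect F 2 1 2} = Set.Icc 0 (tetraAlpha F) := by
  ext δ
  simp only [Set.mem_setOf_eq, Set.mem_Icc]
  constructor
  · rintro ⟨⟨h0, h1⟩, hr⟩
    exact ⟨h0, (sixRung_iff_le_tetraAlpha F h1).1 hr⟩
  · rintro ⟨h0, h⟩
    exact ⟨⟨h0, h.trans (tetraAlpha_le_one F)⟩, sixRung_of_le_tetraAlpha F h⟩

end Alpha

/-! ## §3 The two halves of the leaf, and the leaf, as statements about `α(K₄)` -/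

section Pieces

variable (F : Type) [Field F]

/-- **`SixRungPos ⟺ 0 < α(K₄)`**: the rung half of the line `rung_and_chord` is the positivity of the
tetrahedral dual exponent (the `K₄`-analogue of Coppersmith's theorem `α > 0`). -/
theorem sixRungPos_iff_tetraAlpha_pos :
    (∃ δ : ℝ, 0 < δ ∧ omegaSix F δ ≤ omegaRect F 2 1 2) ↔ 0 < tetraAlpha F := by
  constructor
  · rintro ⟨δ, hδ, hr⟩
    have h1 : min δ 1 ≤ tetraAlpha F :=
      (sixRung_iff_le_tetraAlpha F (min_le_right δ 1)).1 ((omegaSix_mono F (min_le_left δ 1)).trans hr)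
    exact lt_of_lt_of_le (lt_min hδ zero_lt_one) h1
  · intro h
    exact ⟨tetraAlpha F, h, (omegaSix_tetraAlpha F).le⟩

/-- **The leaf ⟺ `α(K₄) = 1`** (the rung at `δ = 1` is the leaf; cf. `α = 1 ⟺ ω = 2`,
`dualExponentAlpha_eq_one_iff`). [cite: VassilevskaWilliamsXuXuZhou2024, §1] -/
theorem excessZero_iff_tetraAlpha_eq_one :
    omegaTetra F ≤ omegaRect F 2 1 2 ↔ tetraAlpha F = 1 := by
  constructor
  · intro hE
    refine le_antisymm (tetraAlpha_le_one F) (le_tetraAlpha F ⟨zero_le_one, le_rfl⟩ ?_)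
    rw [omegaSix_one]
    exact hE
  · intro h
    have h1 : omegaSix F 1 ≤ omegaRect F 2 1 2 := sixRung_of_le_tetraAlpha F h.ge
    rwa [omegaSix_one] at h1

/-- **Payoff, linear pricing**: `ω(K₄) ≤ ω(2,1,2) + (1 − α(K₄))` (the rung at `α(K₄)` and
`omegaTetra_le_of_sixRung`). -/
theorem omegaTetra_le_add_one_sub_tetraAlpha :
    omegaTetra F ≤ omegaRect F 2 1 2 + (1 - tetraAlpha F) :=
  omegaTetra_le_of_sixRung F (tetraAlpha_le_one F) (omegaSix_tetraAlpha F).le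

/-- **Payoff, symmetrised pricing**: `ω(K₄) − ω(2,1,2) ≤ (1 − α(K₄))/(5 + α(K₄)) · ω(2,1,2)`
(`excess_le_of_sixRung_symm` at the rung `α(K₄)`). [cite: ChristandlVranaZuiddam2016, §2.1 (nonuniformsymm)] -/
theorem excess_le_symm_tetraAlpha :
    omegaTetra F - omegaRect F 2 1 2 ≤ (1 - tetraAlpha F) / (5 + tetraAlpha F) * omegaRect F 2 1 2 :=
  excess_le_of_sixRung_symm F (tetraAlpha_nonneg F) (tetraAlpha_le_one F) (omegaSix_tetraAlpha F).le

/-- **The excess caps `α(K₄)`**: `(5 + α(K₄))·ω(K₄) ≤ 6·ω(2,1,2)`, i.e. `α(K₄) ≤ 1 − 6(T − ψ)/T`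
(`le_omegaSix_symm` at `α(K₄)`). [cite: ChristandlVranaZuiddam2016, §2.1 (nonuniformsymm)] -/
theorem five_add_tetraAlpha_mul_le :
    (5 + tetraAlpha F) * omegaTetra F ≤ 6 * omegaRect F 2 1 2 := by
  have h := omegaTetra_le_symm_six F (tetraAlpha_nonneg F) (tetraAlpha_le_one F)
  rw [omegaSix_tetraAlpha, le_div_iff₀ (by linarith [tetraAlpha_nonneg F])] at h
  simpa [mul_comm] using h

end Pieces

/-! ## §4 The profile of `χ` around `α(K₄)`, and the line `rung_and_chord` in this language -/

section Profile

variable (F : Type) [Field F]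

/-- **The chord from the end of the flat part**: for `α(K₄) ≤ δ ≤ 1`, `α(K₄) < 1`:
`(1 − α(K₄))·χ(δ) ≤ (1 − δ)·ω(2,1,2) + (δ − α(K₄))·ω(K₄)` (convexity on `[α(K₄), 1]`; the case
`α(K₄) = 0` is `omegaSix_le_chord`). [cite: LottiRomani1983, §2 (p. 174)] -/
theorem omegaSix_le_chord_tetraAlpha {δ : ℝ} (h₁ : tetraAlpha F ≤ δ) (h₂ : δ ≤ 1)
    (hlt : tetraAlpha F < 1) :
    (1 - tetraAlpha F) * omegaSix F δ ≤
      (1 - δ) * omegaRect F 2 1 2 + (δ - tetraAlpha F) * omegaTetra F := by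
  have h := omegaSix_three_point F (tetraAlpha_nonneg F) h₁ h₂ le_rfl hlt
  rw [omegaSix_tetraAlpha, omegaSix_one] at h
  exact h

/-- **`MidTight ⟹ α(K₄) ∈ {0, 1}`**: an affine non-decreasing ladder flat on a non-trivial initial
interval is flat (`sixRung_iff_excessZero_of_midTight` at `δ = α(K₄)`). [cite: LottiRomani1983, §2 (p. 174)] -/
theorem tetraAlpha_eq_zero_or_eq_one_of_midTight
    (hmid : omegaRect F 2 1 2 + omegaTetra F ≤ 2 * omegaSix F (1 / 2)) :
    tetraAlpha F = 0 ∨ tetraAlpha F = 1 := by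
  rcases (tetraAlpha_nonneg F).eq_or_lt with h0 | hpos
  · exact Or.inl h0.symm
  · exact Or.inr ((excessZero_iff_tetraAlpha_eq_one F).1
      ((sixRung_iff_excessZero_of_midTight F hmid hpos).1 (omegaSix_tetraAlpha F).le))

/-- **The registered line in this language**: `0 < α(K₄) → MidTight → α(K₄) = 1`
(`stub_sixRungPos → stub_midTight → TetraExcessZero`, `tetraExcessZero_of_sixRungPos_of_midTight`). -/
theorem tetraAlpha_eq_one_of_pos_of_midTight (hpos : 0 < tetraAlpha F)
    (hmid : omegaRect F 2 1 2 + omegaTetra F ≤ 2 * omegaSix F (1 / 2)) : tetraAlpha F = 1 :=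
  (tetraAlpha_eq_zero_or_eq_one_of_midTight F hmid).resolve_left hpos.ne'

/-- Conversely `0 < α(K₄) < 1` (a flat part, then growth: a kink at `α(K₄)`) refutes `MidTight`. -/
theorem not_midTight_of_tetraAlpha_mem_Ioo (h : tetraAlpha F ∈ Set.Ioo (0 : ℝ) 1) :
    ¬ omegaRect F 2 1 2 + omegaTetra F ≤ 2 * omegaSix F (1 / 2) := fun hmid => by
  rcases tetraAlpha_eq_zero_or_eq_one_of_midTight F hmid with h0 | h1
  · exact h.1.ne' h0
  · exact h.2.ne h1

end Profile

/-! ## §5 Over `ℂ`, by name: the crux, the summit, and the transfer from Coppersmith's `α` -/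

section Complex

/-- **`TetraExcessZero ⟺ α(K₄)(ℂ) = 1`** (the crux `stmt-MatrixMultiplication-26697` as the value of
one real number). -/
theorem tetraExcessZero_iff_tetraAlpha_eq_one : TetraExcessZero ↔ tetraAlpha ℂ = 1 :=
  excessZero_iff_tetraAlpha_eq_one ℂ

/-- NEC: `ω = 2 ⟹ α(K₄) = 1`. -/
theorem tetraAlpha_eq_one_of_matrixMultiplication (hS : _root_.MatrixMultiplication) :
    tetraAlpha ℂ = 1 :=
  (excessZero_iff_tetraAlpha_eq_one ℂ).1 (excessZero_of_matrixMultiplication hS)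

/-- **A refuter's handle**: any certified `α(K₄)(ℂ) < 1` refutes `ω = 2`. -/
theorem not_matrixMultiplication_of_tetraAlpha_lt_one (h : tetraAlpha ℂ < 1) :
    ¬ _root_.MatrixMultiplication := fun hS =>
  h.ne (tetraAlpha_eq_one_of_matrixMultiplication hS)

/-- **Absolute rung ⟺ `HalfAlpha ∧ 0 < α(K₄)`**: the only absolute (`≤ 4`) form of `0 < α(K₄)`
carries the open `α ≥ 1/2` with it (`absRung_iff_halfAlpha_and_sixRungPos`). [cite: LeGall2012, §1] -/
theorem absRung_iff_halfAlpha_and_tetraAlpha_pos :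
    (∃ δ : ℝ, 0 < δ ∧ omegaSix ℂ δ ≤ 4) ↔ HalfAlpha ∧ 0 < tetraAlpha ℂ := by
  rw [absRung_iff_halfAlpha_and_sixRungPos, sixRungPos_iff_tetraAlpha_pos]

/-- **The route's cut through `α(K₄)`**: `ω = 2 ⟺ α(K₄)(ℂ) = 1 ∧ TetraPlusTwo`
(`closes (hA : TetraExcessZero) (hB : TetraPlusTwo)` and `matrixMultiplication_iff_excessZero_and_plusTwo'`). -/
theorem matrixMultiplication_iff_tetraAlpha_eq_one_and_tetraPlusTwo :
    _root_.MatrixMultiplication ↔ tetraAlpha ℂ = 1 ∧ TetraPlusTwo := by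
  rw [← tetraExcessZero_iff_tetraAlpha_eq_one]
  exact matrixMultiplication_iff_excessZero_and_plusTwo'

/-- **Transfer from `α(K₃)`**: `1/2 < α ⟹ 0 < α(K₄)` (the three-triangle re-routing cover,
`sixRungPos_of_half_lt_dualExponentAlpha`). [cite: ChristandlVranaZuiddam2016, Prop. 1.1.26] -/
theorem tetraAlpha_pos_of_half_lt_dualExponentAlpha (hα : (1 / 2 : ℝ) < dualExponentAlpha ℂ) :
    0 < tetraAlpha ℂ :=
  (sixRungPos_iff_tetraAlpha_pos ℂ).1 (sixRungPos_of_half_lt_dualExponentAlpha hα)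

/-- **Transfer, quantitative**: for `1/2 < a ≤ α(K₃)`, `(1 − 1/(2a))·α₀ ≤ α(K₄)` (`α₀ = log₅4/5`): the
re-routing cover with `x = 1 − 1/(2a)` certifies the rung at `δ = x·α₀` (`ω(x,x,xα₀) = 2x`,
`ω(1−x,1,1/2) ≤ 2 − x`, total `4 ≤ ω(2,1,2)`). [cite: LottiRomani1983, §1 (p. 173)] [cite: Coppersmith1982, Thm. 1] -/
theorem le_tetraAlpha_of_half_lt {a : ℝ} (ha : 1 / 2 < a) (haα : a ≤ dualExponentAlpha ℂ) :
    (1 - 1 / (2 * a)) * coppersmithExponent ≤ tetraAlpha ℂ := by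
  have ha0 : 0 < a := by linarith
  have ha1 : a ≤ 1 := haα.trans (dualExponentAlpha_le_one ℂ)
  set x := 1 - 1 / (2 * a) with hxdef
  have hx0 : 0 < x := by
    rw [hxdef, sub_pos, div_lt_one (by positivity)]; linarith
  have hx1 : x ≤ 1 / 2 := by
    rw [hxdef]
    have : 1 / 2 ≤ 1 / (2 * a) := by
      rw [div_le_div_iff₀ (by norm_num) (by positivity)]; nlinarith
    linarith
  -- the pendant triangle is flat: ω(x,x,xα₀) = 2x
  have hC : omegaRect ℂ x x (x * coppersmithExponent) = 2 * x := by
    have h := LottiRomani1983_homogeneous ℂ (ν := x) (x := 1) (y := 1) (z := coppersmithExponent)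
      hx0.le zero_le_one zero_le_one coppersmithExponent_pos.le
    rw [mul_one] at h
    rw [h, coppersmith1982_omegaRect_eq_two ℂ]; ring
  -- the shrunk big triangles: ω(1-x,1,½) ≤ 2 - x
  have hy : 1 - x = 1 / (2 * a) := by rw [hxdef]; ring
  have hy0 : 0 < 1 - x := by linarith
  have hT : omegaRect ℂ (1 - x) 1 (1 / 2) ≤ 2 - x := by
    have h := LottiRomani1983_homogeneous ℂ (ν := 1 - x) (x := 1) (y := 2 * a) (z := a) hy0.le
      zero_le_one (by positivity) ha0.le
    have e2 : (1 - x) * (2 * a) = 1 := by rw [hy]; field_simp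
    have e3 : (1 - x) * a = 1 / 2 := by rw [hy]; field_simp
    rw [mul_one, e2, e3] at h
    have hLR := omegaRect_add_le_add_pos ℂ 1 1 a 0 (2 * a - 1) 0
    simp only [add_zero] at hLR
    have e4 : (1 : ℝ) + (2 * a - 1) = 2 * a := by ring
    rw [e4, max_eq_left (by linarith : (0 : ℝ) ≤ 2 * a - 1), max_self, zero_add, add_zero] at hLR
    have hflat : omegaRect ℂ 1 1 a = 2 := by
      rw [← omegaRect_one_mid_one ℂ a]; exact omegaRect_eq_two_of_le_dualExponentAlpha ℂ haα
    rw [hflat] at hLR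
    rw [h]
    have : (1 - x) * omegaRect ℂ 1 (2 * a) a ≤ (1 - x) * (2 + (2 * a - 1)) :=
      mul_le_mul_of_nonneg_left hLR hy0.le
    have e5 : (1 - x) * (2 + (2 * a - 1)) = 2 - x := by
      rw [hxdef]; field_simp; ring
    linarith
  have h4 : (4 : ℝ) ≤ omegaRect ℂ 2 1 2 := four_le_omegaRect_two_one_two (F := ℂ)
  have hrung : omegaSix ℂ (x * coppersmithExponent) ≤ omegaRect ℂ 2 1 2 := by
    have hB := reroutingBound ℂ x (x * coppersmithExponent)
    rw [hC] at hB
    linarith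
  have hδ1 : x * coppersmithExponent ≤ 1 := by
    have := coppersmithExponent_lt
    nlinarith
  exact (sixRung_iff_le_tetraAlpha ℂ hδ1).1 hrung

end Complex

end Summit.MatrixMultiplication.MatrixMultiplication.Theorems.EdgePencil

end
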